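import Summits.QuantumFields.YangMills.Theorems.BalabanUVNodesN15KingModelFullPropagatorMixedHolderKernels

/-!
# BalabanUVNodes ∕ N15 — THE KING-MODEL RUNG, CURVED EDITION (PART Ψ-b): THE NEAR FIELD AND THE BOUNDARY TERM OF THE CALDERÓN–ZYGMUND ESTIMATE
# BEHIND [B9] (3.45) AT `U ≡ 1` — `|Σ_y N^{−(d+1)}DD(y, z)w(y)(λ(y) − λ(z))| ≤ C·H·(S∕N)^α·e^{−δD}` for weights `0 ≤ w ≤ 1` living on `|y − z| < S`, and
# `|Σ_y N^{−(d+1)}DD(y, z)χ(y)| ≤ C` for the Lipschitz radial cut-off `χ` (summation by parts to the source gradient, ball counts), for King's full `A = 0`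
# propagator, UNIFORMLY in `K`, the volume and the mass
# (Track A, DAG node N15 = NE2; FAN-OUT v1.1 §N15 s3 «KING-MODEL RUNG … + the one-line statement of what the curved case adds»)

HONEST FRAMING.  Count-neutral kernel bookkeeping (cell `pub-ymgap`, seat `pub-ymgap-dag-n15-e` g10; `--supports stmt-QuantumFields-20544 --as helper` = K3⁷
`SpineGivenEndpointR13SepCoPH`, WORDS-143).  TEMPLATE LITERATURE, `A = 0`: C. King's scalar U(1)-Higgs MODEL on finite tori ([King1986] (2.13) p. 653,
Prop. 3.7 (3.63) p. 663), NOT Bałaban's covariant objects.  [Balaban1985BackgroundPropagators] Thm 3.1 (3.45) p. 398 prints the HÖLDER norm of the mixed object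
`∇_UG(U)∇*_Uλ`; at `U ≡ 1` its kernel representation is part V-b's `F(x) = Σ_y N^{−(d+1)}·DD(y, x)·λ(y)` (`inv_deriv_adjDeriv_eq_sum`) with the cancellation
`Σ_y DD(y, x) = 0` (`sum_mixedKernel_eq_zero`).  THIS FILE proves two of the four pieces of the Calderón–Zygmund split of `F(x′) − F(x)` (the sequel part Ψ-c
assembles): the NEAR-FIELD sums and the BOUNDARY (cut-off) sum.  Decided in the MODEL; NOT the printed proposition; NE2⁺ is NOT PRINTED and not proved; NOT
a node discharge; nothing continuum ∕ ℝ⁴ ∕ OS ∕ mass-gap ∕ Clay.  0 `sorry`, 0 `def`, standard axioms.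

CONTENT.
* §1 `inv_pow_mul_div_pow_mul_rpow` (the scale algebra `N^{−(d+1)}(N∕r)^{d+1}(r∕N)^α = r^{α−(d+1)}N^{−α}`), `exists_pow_two_near` (a dyadic scale `S ≤ 2^k ≤ 2S`);
  ★ **`mixedKernel_nearField_le`** — `0 < α < 1`: one `(C, δ)` such that for every `K ≥ 1`, cube, mass, `μ, ν`, every α-Hölder `λ` (modulus `H`), centre `z`,
  weights `0 ≤ w ≤ 1` vanishing on `|y − z| ≥ S` (`S ≥ 1`) and `D ≤ |B(z) − B(y)|` on `supp λ`:
  `|Σ_y N^{−(d+1)}DD(y, z)w(y)(λ(y) − λ(z))| ≤ C·H·(S∕N)^α·e^{−δD}` — part Ψ-a's power law with decay `|DD| ≲ (N∕r)^{d+1}e^{−δ|B−B′|}` against `H(r∕N)^α`,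
  summed by part Ω `powerSum_dyadic_le_pow_tdistT` (`Σ_{1 ≤ r ≤ 2^k} r^{α−(d+1)} ≲ (2^k)^α`).
* §2 `sum_fwdDiff_mul_eq_sum_mul_bwdDiff` (summation by parts on a finite abelian group), the radial cut-off `χ_R(r) = max 0 (min 1 ((2R − r)∕R))`:
  `radialCutoff_nonneg`∕`_le_one`∕`_eq_one`∕`_eq_zero`∕`abs_radialCutoff_sub_le` (Lipschitz `1∕R`);
  ★ **`mixedKernel_cutoffSum_le`** (`d ≥ 1`) — one `C` such that for every `K ≥ 1`, cube, mass, `μ, ν`, `x ≠ z` (`ρ = |x − z|`, `R = 2ρ + 1`):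
  `|Σ_y N^{−(d+1)}DD(y, z)χ_R(|y − x|)| ≤ C` — `DD(y, z) = N(ψ(y + e_μ) − ψ(y))` with the SOURCE gradient `ψ(y) = N[G(y, z + e_ν) − G(y, z)]`, summation by parts
  moves the difference onto `χ_R` (`|χ_R(|y − e_μ − x|) − χ_R(|y − x|)| ≤ 1∕R`, supported in the annulus `R − 1 < |y − x| < 2R + 1` of `≤ (15ρ)^{d+1}` points, part Ψ-a
  `card_ball_tdistT_le`), where `|y − z| > ρ` and part R-c `fullPropD2_powerLaw_unif` gives `|ψ| ≤ C(N∕ρ)^d`; the prefactors `N^{−(d+1)}·N·(N∕ρ)^d·ρ^{d+1}∕R` are `O(1)`.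
* §3 `mixedKernel_holder_split` — the EXACT four-term split of `Σ cDD′λ − Σ cDDλ` (near ∕ near ∕ far ∕ boundary) from the two cancellations (pure algebra).
WHAT THE CURVED CASE ADDS (one line): the same two pieces for `∇_UG_k(U)∇*_U` over `Reg335` on the multiscale carrier — inside Bałaban's proof of (3.45).
HONEST SCOPE.  (i) `A = 0`, periodic b.c., odd `L ≥ 3`, `0 < m² ≤ m₀²`, cubes `2L^e`, `K ≥ 1`; (ii) King's spelling, lattice units of level `K`, sup torus
distance, forward η-differences; (iii) GLOBAL Hölder modulus of `λ` (as in parts V-b∕V-c); (iv) §2 needs `d ≥ 1` (the gradient power law); (v) not Bałaban's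
`G_k(U)`; not a discharge.
Locators: [King1986] (2.13) p. 653, Prop. 3.7 (3.63)∕(3.65) p. 663, Theorem 3.3 (3.7) p. 656; [Balaban1985BackgroundPropagators] Thm 3.1 (3.45) p. 398.
-/

noncomputable section

namespace Summit.QuantumFields.YangMills.BalabanUVNodes.N15KingModelRung.Curved

open Real Finset Matrix
open Literature.MathematicalPhysics.QuantumFieldTheory.Balaban1983to89.B5Prop11Plancherel (Tor fine unitVec)
open Literature.MathematicalPhysics.QuantumFieldTheory.King1986 (aK aK_pos)
open Literature.MathematicalPhysics.QuantumFieldTheory.King1986.Torus (constrainedProp blockOf tdistT tdistT_nonneg tdistT_symm tdistT_self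
  tdistT_triangle abs_tdistT_sub_le tdistT_sub_unitVec_le)

variable {d : ℕ} (L : ℕ) [NeZero L]

/-! ## §1 The near field -/

omit [NeZero L] in
/-- The scale algebra of the near field: `N^{−n}·(N∕r)^n·(r∕N)^α = r^{α−n}·N^{−α}` (`N, r > 0`). [folklore] -/
theorem inv_pow_mul_div_pow_mul_rpow {N r α : ℝ} (hN : 0 < N) (hr : 0 < r) (n : ℕ) :
    (N ^ n)⁻¹ * (N / r) ^ n * (r / N) ^ α = r ^ (α - n) * N ^ (-α) := by
  rw [Real.rpow_sub hr, Real.rpow_natCast, Real.rpow_neg hN.le, Real.div_rpow hr.le hN.le, div_pow]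
  field_simp

omit [NeZero L] in
/-- A dyadic scale just above `S ≥ 1`: `S ≤ 2^k ≤ 2S`. [folklore] -/
theorem exists_pow_two_near {S : ℝ} (hS : 1 ≤ S) : ∃ k : ℕ, S ≤ (2 : ℝ) ^ k ∧ (2 : ℝ) ^ k ≤ 2 * S := by
  have hS0 : 0 ≤ S := by linarith
  have hfl : ⌊S⌋₊ ≠ 0 := Nat.pos_iff_ne_zero.mp (Nat.floor_pos.mpr hS)
  refine ⟨Nat.log 2 ⌊S⌋₊ + 1, ?_, ?_⟩
  · have h1 : ⌊S⌋₊ < 2 ^ (Nat.log 2 ⌊S⌋₊ + 1) := Nat.lt_pow_succ_log_self (by norm_num) _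
    have h2 : (⌊S⌋₊ : ℝ) + 1 ≤ ((2 ^ (Nat.log 2 ⌊S⌋₊ + 1) : ℕ) : ℝ) := by exact_mod_cast h1
    push_cast at h2
    linarith [Nat.lt_floor_add_one S]
  · have h1 : 2 ^ Nat.log 2 ⌊S⌋₊ ≤ ⌊S⌋₊ := Nat.pow_log_le_self 2 hfl
    have h2 : ((2 ^ Nat.log 2 ⌊S⌋₊ : ℕ) : ℝ) ≤ (⌊S⌋₊ : ℝ) := by exact_mod_cast h1
    push_cast at h2
    rw [pow_succ]
    linarith [Nat.floor_le hS0]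

/-- ★ **THE NEAR FIELD**: for odd `L ≥ 3`, `a > 0`, `m₀² ≥ 0` and `0 < α < 1` there are `C, δ > 0` such that for EVERY `K ≥ 1` (`N = L^K`), cube `2L^e`,
mass `0 < m² ≤ m₀²`, directions `μ, ν`, every source `λ` with `|λ(y) − λ(y′)| ≤ H·(|y − y′|∕N)^α` (`H ≥ 0`), every centre `z`, radius `S ≥ 1`, weights
`0 ≤ w ≤ 1` with `w(y) = 0` whenever `|y − z| ≥ S`, and every `D` with `D ≤ |B(z) − B(y)|_M` whenever `λ(y) ≠ 0`:
`|Σ_y N^{−(d+1)}·DD(y, z)·w(y)·(λ(y) − λ(z))| ≤ C·H·(S∕N)^α·exp(−δD)`, `DD(y, z) = N(N[G(y + e_μ, z + e_ν) − G(y, z + e_ν)] − N[G(y + e_μ, z) − G(y, z)])` —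
the kernel's power law with decay (part Ψ-a) against the Hölder gain `H(r∕N)^α`: `N^{−(d+1)}(N∕r)^{d+1}(r∕N)^α = N^{−α}r^{α−(d+1)}`, and
`Σ_{1 ≤ r ≤ 2^k} r^{α−(d+1)} ≤ C_Ω(2^k)^α` (part Ω) at the dyadic scale `S ≤ 2^k ≤ 2S`.
[cite: King1986, Prop. 3.7 (3.63) p.663, Theorem 3.3 (3.7) p.656; Balaban1985BackgroundPropagators, Thm 3.1 (3.45) p.398] -/
theorem mixedKernel_nearField_le (hLodd : Odd L) (hL : 2 ≤ L) {a : ℝ} (ha : 0 < a) {m0sq : ℝ} (hm0 : 0 ≤ m0sq)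
    {α : ℝ} (hα0 : 0 < α) (hα1 : α < 1) :
    ∃ C δ : ℝ, 0 < C ∧ 0 < δ ∧ ∀ (K : ℕ), 1 ≤ K → ∀ (N : ℕ) [NeZero N], N = L ^ K →
      ∀ (e : ℕ) (M : Fin (d + 1) → ℕ) [∀ μ, NeZero (M μ)], (∀ μ, M μ = 2 * L ^ e) →
      ∀ (msq : ℝ), 0 < msq → msq ≤ m0sq → ∀ (μ ν : Fin (d + 1)) (lam : Tor (fine N M) → ℝ) (H : ℝ),
        0 ≤ H → (∀ y y', |lam y - lam y'| ≤ H * (tdistT (fine N M) y y' / (N : ℝ)) ^ α) →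
        ∀ (z : Tor (fine N M)) (S : ℝ), 1 ≤ S → ∀ (w : Tor (fine N M) → ℝ), (∀ y, 0 ≤ w y) → (∀ y, w y ≤ 1) →
        (∀ y, S ≤ tdistT (fine N M) z y → w y = 0) →
        ∀ (D : ℝ), (∀ y, lam y ≠ 0 → D ≤ tdistT M (blockOf N M z) (blockOf N M y)) →
        |∑ y, ((N : ℝ) ^ (d + 1))⁻¹
            * ((N : ℝ) * ((N : ℝ) * (constrainedProp N M (aK a L K) (((N : ℕ) : ℝ) ^ 2) msq (y + unitVec (fine N M) μ) (z + unitVec (fine N M) ν)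
                - constrainedProp N M (aK a L K) (((N : ℕ) : ℝ) ^ 2) msq y (z + unitVec (fine N M) ν))
              - (N : ℝ) * (constrainedProp N M (aK a L K) (((N : ℕ) : ℝ) ^ 2) msq (y + unitVec (fine N M) μ) z
                - constrainedProp N M (aK a L K) (((N : ℕ) : ℝ) ^ 2) msq y z)))
            * w y * (lam y - lam z)|
          ≤ C * H * (S / (N : ℝ)) ^ α * Real.exp (-(δ * D)) := by
  obtain ⟨C₀, δ, hC₀, hδ, HDD⟩ := fullPropDD_powerLaw_decay_unif (d := d) L hLodd hL ha hm0
  -- part Ω's constant at `θ = α`, `d′ = d + 1`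
  set CΩ : ℝ := (3 : ℝ) ^ (d + 1) + (5 : ℝ) ^ (d + 1) * ((2 : ℝ) ^ α / ((2 : ℝ) ^ α - 1)) with hCΩ
  have h2α : 1 < (2 : ℝ) ^ α := Real.one_lt_rpow (by norm_num) hα0
  have hCΩ0 : 0 < CΩ := by
    have : 0 < (2 : ℝ) ^ α / ((2 : ℝ) ^ α - 1) := div_pos (by linarith) (by linarith)
    positivity
  refine ⟨C₀ * CΩ * 2, δ, by positivity, hδ, ?_⟩
  intro K hK N _ hN e M _ hM msq hmsq hcap μ ν lam H hH0 hH z S hS w hw0 hw1 hwS D hD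
  have hN1 : (1 : ℝ) ≤ (N : ℝ) := by rw [hN]; exact_mod_cast Nat.one_le_pow K L (by omega)
  have hN0 : 0 < (N : ℝ) := by linarith
  have hS0 : 0 < S := by linarith
  obtain ⟨k, hSk, hkS⟩ := exists_pow_two_near hS
  -- the kernel at the centre `z`, as a named function of the source point
  obtain ⟨DDk, hDDk⟩ : ∃ f : Tor (fine N M) → ℝ, ∀ y, f y
      = (N : ℝ) * ((N : ℝ) * (constrainedProp N M (aK a L K) (((N : ℕ) : ℝ) ^ 2) msq (y + unitVec (fine N M) μ) (z + unitVec (fine N M) ν)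
            - constrainedProp N M (aK a L K) (((N : ℕ) : ℝ) ^ 2) msq y (z + unitVec (fine N M) ν))
          - (N : ℝ) * (constrainedProp N M (aK a L K) (((N : ℕ) : ℝ) ^ 2) msq (y + unitVec (fine N M) μ) z
            - constrainedProp N M (aK a L K) (((N : ℕ) : ℝ) ^ 2) msq y z)) := ⟨_, fun _ => rfl⟩
  rw [Finset.sum_congr rfl fun y _ => by rw [← hDDk y]]
  set c : ℝ := ((N : ℝ) ^ (d + 1))⁻¹ with hcdef
  have hc0 : 0 < c := by positivity
  -- the common amplitude
  set A : ℝ := C₀ * H * (N : ℝ) ^ (-α) * Real.exp (-(δ * D)) with hAdef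
  have hA0 : 0 ≤ A := by positivity
  -- termwise: `|c·DD(y)·w(y)·(λ y − λ z)| ≤ A·[1 ≤ |y−z| ≤ 2^k]·|y − z|^{α−(d+1)}`
  have hterm : ∀ y, |c * DDk y * w y * (lam y - lam z)|
      ≤ A * (if (1 ≤ tdistT (fine N M) z y ∧ tdistT (fine N M) z y ≤ (2 : ℝ) ^ k)
          then tdistT (fine N M) z y ^ (α - ((d + 1 : ℕ) : ℝ)) else 0) := by
    intro y
    by_cases hyz : lam y = lam z
    · rw [hyz, sub_self, mul_zero, abs_zero]
      split_ifs
      · exact mul_nonneg hA0 (Real.rpow_nonneg (tdistT_nonneg _ _ _) _)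
      · rw [mul_zero]
    have hne : y ≠ z := fun h => hyz (by rw [h])
    set r : ℝ := tdistT (fine N M) z y with hrdef
    have hr1 : 1 ≤ r := by rw [hrdef, tdistT_symm]; exact one_le_tdistT_of_ne (fine N M) hne
    have hr0 : 0 < r := by linarith
    by_cases hwy : w y = 0
    · rw [hwy, mul_zero, zero_mul, abs_zero]
      split_ifs
      · exact mul_nonneg hA0 (Real.rpow_nonneg hr0.le _)
      · rw [mul_zero]
    -- inside the ball: `r < S ≤ 2^k`
    have hrS : r < S := by
      by_contra h
      exact hwy (hwS y (not_lt.mp h))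
    have hcond : 1 ≤ tdistT (fine N M) z y ∧ tdistT (fine N M) z y ≤ (2 : ℝ) ^ k := ⟨hr1, by linarith⟩
    rw [if_pos hcond]
    -- the kernel's power law with decay at `(y, z)`
    have hdd : |DDk y| ≤ C₀ * (((L : ℝ) ^ K) / tdistT (fine N M) y z) ^ (d + 1)
        * Real.exp (-(δ * tdistT M (blockOf N M y) (blockOf N M z))) := by
      rw [hDDk]; exact HDD K hK N hN e M hM msq hmsq hcap μ ν y z hne
    rw [tdistT_symm] at hdd
    have hNK : ((L : ℝ) ^ K) = (N : ℝ) := by rw [hN, Nat.cast_pow]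
    rw [hNK] at hdd
    -- the decay read at `D`
    have hdec : Real.exp (-(δ * tdistT M (blockOf N M y) (blockOf N M z))) ≤ Real.exp (-(δ * D)) := by
      apply Real.exp_le_exp.mpr
      by_cases hy0 : lam y = 0
      · have hz0 : lam z ≠ 0 := fun h => hyz (by rw [hy0, h])
        have hD0 : D ≤ 0 := by have h := hD z hz0; rwa [tdistT_self] at h
        have := tdistT_nonneg M (blockOf N M y) (blockOf N M z)
        nlinarith
      · have hDy := hD y hy0
        rw [tdistT_symm] at hDy
        nlinarith
    have hHy : |lam y - lam z| ≤ H * (r / (N : ℝ)) ^ α := by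
      have h := hH y z; rwa [tdistT_symm] at h
    have hscale : c * ((N : ℝ) / r) ^ (d + 1) * (r / (N : ℝ)) ^ α = r ^ (α - ((d + 1 : ℕ) : ℝ)) * (N : ℝ) ^ (-α) :=
      inv_pow_mul_div_pow_mul_rpow hN0 hr0 (d + 1)
    calc |c * DDk y * w y * (lam y - lam z)| = c * |DDk y| * w y * |lam y - lam z| := by
          rw [abs_mul, abs_mul, abs_mul, abs_of_pos hc0, abs_of_nonneg (hw0 y)]
      _ ≤ c * (C₀ * ((N : ℝ) / r) ^ (d + 1) * Real.exp (-(δ * D))) * 1 * (H * (r / (N : ℝ)) ^ α) := by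
          refine mul_le_mul (mul_le_mul (mul_le_mul_of_nonneg_left (hdd.trans
            (mul_le_mul_of_nonneg_left hdec (by positivity))) hc0.le) (hw1 y) (hw0 y) (by positivity)) hHy (abs_nonneg _)
            (by positivity)
      _ = C₀ * H * Real.exp (-(δ * D)) * (c * ((N : ℝ) / r) ^ (d + 1) * (r / (N : ℝ)) ^ α) := by ring
      _ = A * r ^ (α - ((d + 1 : ℕ) : ℝ)) := by rw [hscale, hAdef]; ring
  -- sum: part Ω at the dyadic scale `2^k`
  have hΩ := powerSum_dyadic_le_pow_tdistT (fine N M) z hα0 (by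
    have : (1 : ℝ) ≤ ((d + 1 : ℕ) : ℝ) := by exact_mod_cast Nat.le_add_left 1 d
    linarith) k
  have h2k : ((2 : ℝ) ^ k) ^ α ≤ 2 * S ^ α := by
    calc ((2 : ℝ) ^ k) ^ α ≤ (2 * S) ^ α := Real.rpow_le_rpow (by positivity) hkS hα0.le
      _ = (2 : ℝ) ^ α * S ^ α := Real.mul_rpow (by norm_num) hS0.le
      _ ≤ 2 * S ^ α := by
          refine mul_le_mul_of_nonneg_right ?_ (Real.rpow_nonneg hS0.le _)
          calc (2 : ℝ) ^ α ≤ (2 : ℝ) ^ (1 : ℝ) := Real.rpow_le_rpow_of_exponent_le (by norm_num) hα1.le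
            _ = 2 := Real.rpow_one _
  have hSN : (N : ℝ) ^ (-α) * S ^ α = (S / (N : ℝ)) ^ α := by
    rw [Real.div_rpow hS0.le hN0.le, Real.rpow_neg hN0.le]; ring
  calc |∑ y, c * DDk y * w y * (lam y - lam z)| ≤ ∑ y, |c * DDk y * w y * (lam y - lam z)| := Finset.abs_sum_le_sum_abs _ _
    _ ≤ ∑ y, A * (if (1 ≤ tdistT (fine N M) z y ∧ tdistT (fine N M) z y ≤ (2 : ℝ) ^ k)
          then tdistT (fine N M) z y ^ (α - ((d + 1 : ℕ) : ℝ)) else 0) := Finset.sum_le_sum fun y _ => hterm y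
    _ = A * ∑ y ∈ Finset.univ.filter (fun y => 1 ≤ tdistT (fine N M) z y ∧ tdistT (fine N M) z y ≤ (2 : ℝ) ^ k),
          tdistT (fine N M) z y ^ (α - ((d + 1 : ℕ) : ℝ)) := by rw [← Finset.mul_sum, Finset.sum_filter]
    _ ≤ A * (CΩ * ((2 : ℝ) ^ k) ^ α) := mul_le_mul_of_nonneg_left hΩ hA0
    _ ≤ A * (CΩ * (2 * S ^ α)) := mul_le_mul_of_nonneg_left (mul_le_mul_of_nonneg_left h2k hCΩ0.le) hA0
    _ = C₀ * CΩ * 2 * H * ((N : ℝ) ^ (-α) * S ^ α) * Real.exp (-(δ * D)) := by rw [hAdef]; ring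
    _ = C₀ * CΩ * 2 * H * (S / (N : ℝ)) ^ α * Real.exp (-(δ * D)) := by rw [hSN]

/-! ## §2 The boundary term: summation by parts onto the Lipschitz radial cut-off -/

omit [NeZero L] in
/-- **Summation by parts on a finite abelian group**: `Σ_y (ψ(y + e) − ψ(y))·χ(y) = Σ_y ψ(y)·(χ(y − e) − χ(y))`. [folklore] -/
theorem sum_fwdDiff_mul_eq_sum_mul_bwdDiff {T : Type*} [AddCommGroup T] [Fintype T] (e : T) (ψ χ : T → ℝ) :
    ∑ y, (ψ (y + e) - ψ y) * χ y = ∑ y, ψ y * (χ (y - e) - χ y) := by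
  have hshift : ∑ y, ψ (y + e) * χ y = ∑ y, ψ y * χ (y - e) := by
    have h := Equiv.sum_comp (Equiv.addRight e) (fun u => ψ u * χ (u - e))
    simpa only [Equiv.coe_addRight, add_sub_cancel_right] using h
  simp only [sub_mul, mul_sub, Finset.sum_sub_distrib, hshift]

omit [NeZero L] in
/-- The radial cut-off `χ_R(r) = max 0 (min 1 ((2R − r)∕R))` is `≥ 0`. [folklore] -/
theorem radialCutoff_nonneg (R r : ℝ) : 0 ≤ max 0 (min 1 ((2 * R - r) / R)) := le_max_left _ _

omit [NeZero L] in
/-- The radial cut-off is `≤ 1`. [folklore] -/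
theorem radialCutoff_le_one (R r : ℝ) : max 0 (min 1 ((2 * R - r) / R)) ≤ 1 := max_le zero_le_one (min_le_left _ _)

omit [NeZero L] in
/-- The radial cut-off is `1` on the ball `r ≤ R` (`R > 0`). [folklore] -/
theorem radialCutoff_eq_one {R r : ℝ} (hR : 0 < R) (h : r ≤ R) : max 0 (min 1 ((2 * R - r) / R)) = 1 := by
  have h1 : 1 ≤ (2 * R - r) / R := by rw [le_div_iff₀ hR]; linarith
  rw [min_eq_left h1, max_eq_right zero_le_one]

omit [NeZero L] in
/-- The radial cut-off vanishes off the ball `r ≥ 2R` (`R > 0`). [folklore] -/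
theorem radialCutoff_eq_zero {R r : ℝ} (hR : 0 < R) (h : 2 * R ≤ r) : max 0 (min 1 ((2 * R - r) / R)) = 0 := by
  have h1 : (2 * R - r) / R ≤ 0 := div_nonpos_of_nonpos_of_nonneg (by linarith) hR.le
  rw [min_eq_right (by linarith), max_eq_left h1]

omit [NeZero L] in
/-- The radial cut-off is Lipschitz with constant `1∕R` in the radius (`R > 0`): `|χ_R(r′) − χ_R(r)| ≤ |r − r′|∕R`. [folklore] -/
theorem abs_radialCutoff_sub_le {R : ℝ} (hR : 0 < R) (r r' : ℝ) :
    |max 0 (min 1 ((2 * R - r') / R)) - max 0 (min 1 ((2 * R - r) / R))| ≤ |r - r'| / R := by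
  calc |max 0 (min 1 ((2 * R - r') / R)) - max 0 (min 1 ((2 * R - r) / R))|
      ≤ max |(0 : ℝ) - 0| |min 1 ((2 * R - r') / R) - min 1 ((2 * R - r) / R)| := abs_max_sub_max_le_max _ _ _ _
    _ = |min 1 ((2 * R - r') / R) - min 1 ((2 * R - r) / R)| := by rw [sub_self, abs_zero, max_eq_right (abs_nonneg _)]
    _ ≤ max |(1 : ℝ) - 1| |(2 * R - r') / R - (2 * R - r) / R| := abs_min_sub_min_le_max _ _ _ _
    _ = |(2 * R - r') / R - (2 * R - r) / R| := by rw [sub_self, abs_zero, max_eq_right (abs_nonneg _)]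
    _ = |r - r'| / R := by rw [← sub_div, abs_div, abs_of_pos hR]; ring_nf

/-- ★ **THE BOUNDARY TERM**: for `d ≥ 1`, odd `L ≥ 3`, `a > 0`, `m₀² ≥ 0` there is `C > 0` such that for EVERY `K ≥ 1` (`N = L^K`), cube `2L^e`, mass
`0 < m² ≤ m₀²`, directions `μ, ν` and fine points `x ≠ z` (`ρ = |x − z| ≥ 1`, `R = 2ρ + 1`):
`|Σ_y N^{−(d+1)}·DD(y, z)·χ_R(|y − x|)| ≤ C`, `χ_R(r) = max 0 (min 1 ((2R − r)∕R))` — the mixed kernel is `N(ψ(y + e_μ) − ψ(y))` with the SOURCE gradient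
`ψ(y) = N[G(y, z + e_ν) − G(y, z)]`; summation by parts puts the difference on the Lipschitz cut-off (`≤ 1∕R`, supported where `R − 1 < |y − x| < 2R + 1`, a set of
`≤ (15ρ)^{d+1}` points — part Ψ-a `card_ball_tdistT_le`), on which `|y − z| > ρ` and part R-c `fullPropD2_powerLaw_unif` gives `|ψ(y)| ≤ C₀(N∕ρ)^d`; the product
`N^{−(d+1)}·N·(15ρ)^{d+1}·R^{−1}·C₀(N∕ρ)^d ≤ 15^{d+1}C₀` is uniform.  This is the term `(λ(x′) − λ(x))·Σ_y N^{−(d+1)}DD(y, x′)χ(y)` of the Calderón–Zygmund split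
behind [B9] (3.45) at `U ≡ 1`. [cite: King1986, Prop. 3.7 (3.63) p.663, (2.13) p.653; Balaban1985BackgroundPropagators, Thm 3.1 (3.45) p.398] -/
theorem mixedKernel_cutoffSum_le (hd : 1 ≤ d) (hLodd : Odd L) (hL : 2 ≤ L) {a : ℝ} (ha : 0 < a) {m0sq : ℝ} (hm0 : 0 ≤ m0sq) :
    ∃ C : ℝ, 0 < C ∧ ∀ (K : ℕ), 1 ≤ K → ∀ (N : ℕ) [NeZero N], N = L ^ K →
      ∀ (e : ℕ) (M : Fin (d + 1) → ℕ) [∀ μ, NeZero (M μ)], (∀ μ, M μ = 2 * L ^ e) →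
      ∀ (msq : ℝ), 0 < msq → msq ≤ m0sq → ∀ (μ ν : Fin (d + 1)) (x z : Tor (fine N M)), x ≠ z →
        |∑ y, ((N : ℝ) ^ (d + 1))⁻¹
            * ((N : ℝ) * ((N : ℝ) * (constrainedProp N M (aK a L K) (((N : ℕ) : ℝ) ^ 2) msq (y + unitVec (fine N M) μ) (z + unitVec (fine N M) ν)
                - constrainedProp N M (aK a L K) (((N : ℕ) : ℝ) ^ 2) msq y (z + unitVec (fine N M) ν))
              - (N : ℝ) * (constrainedProp N M (aK a L K) (((N : ℕ) : ℝ) ^ 2) msq (y + unitVec (fine N M) μ) z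
                - constrainedProp N M (aK a L K) (((N : ℕ) : ℝ) ^ 2) msq y z)))
            * max 0 (min 1 ((2 * (2 * tdistT (fine N M) x z + 1) - tdistT (fine N M) x y) / (2 * tdistT (fine N M) x z + 1)))|
          ≤ C := by
  obtain ⟨C₀, hC₀, HD2⟩ := fullPropD2_powerLaw_unif (d := d) L hd hLodd hL ha hm0
  refine ⟨C₀ * (15 : ℝ) ^ (d + 1), by positivity, ?_⟩
  intro K hK N _ hN e M _ hM msq hmsq hcap μ ν x z hxz
  have hN1 : (1 : ℝ) ≤ (N : ℝ) := by rw [hN]; exact_mod_cast Nat.one_le_pow K L (by omega)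
  have hN0 : 0 < (N : ℝ) := by linarith
  have hNK : ((L : ℝ) ^ K) = (N : ℝ) := by rw [hN, Nat.cast_pow]
  set ρ : ℝ := tdistT (fine N M) x z with hρdef
  have hρ1 : 1 ≤ ρ := one_le_tdistT_of_ne (fine N M) hxz
  have hρ0 : 0 < ρ := by linarith
  set R : ℝ := 2 * ρ + 1 with hRdef
  have hR0 : 0 < R := by positivity
  -- the source gradient `ψ` and the cut-off `χ` as named functions
  obtain ⟨ψ, hψ⟩ : ∃ f : Tor (fine N M) → ℝ, ∀ y, f y
      = (N : ℝ) * (constrainedProp N M (aK a L K) (((N : ℕ) : ℝ) ^ 2) msq y (z + unitVec (fine N M) ν)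
          - constrainedProp N M (aK a L K) (((N : ℕ) : ℝ) ^ 2) msq y z) := ⟨_, fun _ => rfl⟩
  obtain ⟨χ, hχ⟩ : ∃ f : Tor (fine N M) → ℝ, ∀ y, f y = max 0 (min 1 ((2 * R - tdistT (fine N M) x y) / R)) := ⟨_, fun _ => rfl⟩
  set c : ℝ := ((N : ℝ) ^ (d + 1))⁻¹ with hcdef
  have hc0 : 0 < c := by positivity
  -- the kernel is `N·(ψ(y + e_μ) − ψ(y))`
  have hker : ∀ y, (N : ℝ) * ((N : ℝ) * (constrainedProp N M (aK a L K) (((N : ℕ) : ℝ) ^ 2) msq (y + unitVec (fine N M) μ) (z + unitVec (fine N M) ν)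
          - constrainedProp N M (aK a L K) (((N : ℕ) : ℝ) ^ 2) msq y (z + unitVec (fine N M) ν))
        - (N : ℝ) * (constrainedProp N M (aK a L K) (((N : ℕ) : ℝ) ^ 2) msq (y + unitVec (fine N M) μ) z
          - constrainedProp N M (aK a L K) (((N : ℕ) : ℝ) ^ 2) msq y z))
      = (N : ℝ) * (ψ (y + unitVec (fine N M) μ) - ψ y) := fun y => by rw [hψ, hψ]; ring
  have hrw : ∀ y, c * ((N : ℝ) * ((N : ℝ) * (constrainedProp N M (aK a L K) (((N : ℕ) : ℝ) ^ 2) msq (y + unitVec (fine N M) μ) (z + unitVec (fine N M) ν)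
          - constrainedProp N M (aK a L K) (((N : ℕ) : ℝ) ^ 2) msq y (z + unitVec (fine N M) ν))
        - (N : ℝ) * (constrainedProp N M (aK a L K) (((N : ℕ) : ℝ) ^ 2) msq (y + unitVec (fine N M) μ) z
          - constrainedProp N M (aK a L K) (((N : ℕ) : ℝ) ^ 2) msq y z)))
        * max 0 (min 1 ((2 * (2 * tdistT (fine N M) x z + 1) - tdistT (fine N M) x y) / (2 * tdistT (fine N M) x z + 1)))
      = c * (N : ℝ) * ((ψ (y + unitVec (fine N M) μ) - ψ y) * χ y) := fun y => by rw [hker, hχ]; ring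
  rw [Finset.sum_congr rfl fun y _ => hrw y, ← Finset.mul_sum, sum_fwdDiff_mul_eq_sum_mul_bwdDiff]
  -- termwise: `|ψ(y)·(χ(y − e_μ) − χ(y))| ≤ [|y − x| < 2R + 1]·C₀(N∕ρ)^d∕R`
  set B : ℝ := C₀ * ((N : ℝ) / ρ) ^ d / R with hBdef
  have hB0 : 0 ≤ B := by positivity
  have hterm : ∀ y, |ψ y * (χ (y - unitVec (fine N M) μ) - χ y)|
      ≤ if tdistT (fine N M) x y < 2 * R + 1 then B else 0 := by
    intro y
    set r : ℝ := tdistT (fine N M) x y with hrdef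
    set r' : ℝ := tdistT (fine N M) x (y - unitVec (fine N M) μ) with hr'def
    have hrr' : |r - r'| ≤ 1 := by
      rw [hrdef, hr'def, tdistT_symm (fine N M) x y, tdistT_symm (fine N M) x (y - unitVec (fine N M) μ)]
      exact (abs_tdistT_sub_le (fine N M) y (y - unitVec (fine N M) μ) x).trans (tdistT_sub_unitVec_le (fine N M) y μ)
    have hχy : χ y = max 0 (min 1 ((2 * R - r) / R)) := hχ y
    have hχy' : χ (y - unitVec (fine N M) μ) = max 0 (min 1 ((2 * R - r') / R)) := hχ _
    split_ifs with hlt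
    · by_cases hlow : r ≤ R - 1
      · -- both cut-offs are `1`
        have h1 : r' ≤ R := by have := (abs_le.mp hrr').1; linarith
        rw [hχy, hχy', radialCutoff_eq_one hR0 h1, radialCutoff_eq_one hR0 (by linarith), sub_self, mul_zero, abs_zero]
        exact hB0
      · -- the annulus: `y` is far from `z`
        have hlow : R - 1 < r := not_le.mp hlow
        have hyz : ρ < tdistT (fine N M) y z := by
          have ht := tdistT_triangle (fine N M) x z y
          rw [← hρdef, ← hrdef, tdistT_symm (fine N M) z y] at ht
          rw [hRdef] at hlow
          linarith
        have hne : y ≠ z := by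
          intro h; rw [h, tdistT_self] at hyz; linarith
        have hψy : |ψ y| ≤ C₀ * ((N : ℝ) / ρ) ^ d := by
          rw [hψ]
          have h := HD2 K hK N hN e M hM msq hmsq hcap ν y z hne
          rw [hNK] at h
          refine h.trans (mul_le_mul_of_nonneg_left ?_ hC₀.le)
          exact pow_le_pow_left₀ (div_nonneg hN0.le (tdistT_nonneg _ _ _)) (div_le_div_of_nonneg_left hN0.le hρ0 hyz.le) d
        have hdiff : |χ (y - unitVec (fine N M) μ) - χ y| ≤ 1 / R := by
          rw [hχy, hχy']
          exact (abs_radialCutoff_sub_le hR0 r r').trans (div_le_div_of_nonneg_right hrr' hR0.le)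
        calc |ψ y * (χ (y - unitVec (fine N M) μ) - χ y)| = |ψ y| * |χ (y - unitVec (fine N M) μ) - χ y| := abs_mul _ _
          _ ≤ C₀ * ((N : ℝ) / ρ) ^ d * (1 / R) := mul_le_mul hψy hdiff (abs_nonneg _) (by positivity)
          _ = B := by rw [hBdef]; ring
    · -- beyond `2R + 1`: both cut-offs vanish
      have hlt : 2 * R + 1 ≤ r := not_lt.mp hlt
      have h1 : 2 * R ≤ r' := by have := (abs_le.mp hrr').2; linarith
      rw [hχy, hχy', radialCutoff_eq_zero hR0 h1, radialCutoff_eq_zero hR0 (by linarith), sub_self, mul_zero, abs_zero]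
  -- the count of the annulus (inside the ball of radius `2R + 1`)
  have hcard : ((Finset.univ.filter fun y : Tor (fine N M) => tdistT (fine N M) x y < 2 * R + 1).card : ℝ)
      ≤ ((15 : ℝ) * ρ) ^ (d + 1) := by
    have hsub : (Finset.univ.filter fun y : Tor (fine N M) => tdistT (fine N M) x y < 2 * R + 1)
        ⊆ (Finset.univ.filter fun y : Tor (fine N M) => tdistT (fine N M) x y ≤ 2 * R + 1) := by
      intro y hy
      rw [Finset.mem_filter] at hy ⊢
      exact ⟨hy.1, hy.2.le⟩
    have hb := card_ball_tdistT_le (fine N M) x (r := 2 * R + 1) (by positivity)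
    have h1 : ((Finset.univ.filter fun y : Tor (fine N M) => tdistT (fine N M) x y < 2 * R + 1).card : ℝ)
        ≤ ((2 * ⌊2 * R + 1⌋₊ + 1 : ℕ) : ℝ) ^ (d + 1) := by
      exact_mod_cast (Finset.card_le_card hsub).trans hb
    refine h1.trans (pow_le_pow_left₀ (by positivity) ?_ (d + 1))
    have hfl : (⌊2 * R + 1⌋₊ : ℝ) ≤ 2 * R + 1 := Nat.floor_le (by positivity)
    push_cast
    rw [hRdef] at hfl ⊢
    linarith
  -- assemble
  have hsum : |∑ y, ψ y * (χ (y - unitVec (fine N M) μ) - χ y)| ≤ B * ((15 : ℝ) * ρ) ^ (d + 1) := by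
    calc |∑ y, ψ y * (χ (y - unitVec (fine N M) μ) - χ y)| ≤ ∑ y, |ψ y * (χ (y - unitVec (fine N M) μ) - χ y)| :=
          Finset.abs_sum_le_sum_abs _ _
      _ ≤ ∑ y, (if tdistT (fine N M) x y < 2 * R + 1 then B else 0) := Finset.sum_le_sum fun y _ => hterm y
      _ = B * ((Finset.univ.filter fun y : Tor (fine N M) => tdistT (fine N M) x y < 2 * R + 1).card : ℝ) := by
          rw [← Finset.sum_filter, Finset.sum_const, nsmul_eq_mul, mul_comm]
      _ ≤ B * ((15 : ℝ) * ρ) ^ (d + 1) := mul_le_mul_of_nonneg_left hcard hB0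
  have hcN : c * (N : ℝ) * (((N : ℝ) / ρ) ^ d * ρ ^ (d + 1)) = ρ := by
    rw [hcdef, div_pow, pow_succ, pow_succ]
    field_simp
  have hρR : ρ / R ≤ 1 := by rw [div_le_one hR0, hRdef]; linarith
  calc |c * (N : ℝ) * ∑ y, ψ y * (χ (y - unitVec (fine N M) μ) - χ y)|
      = c * (N : ℝ) * |∑ y, ψ y * (χ (y - unitVec (fine N M) μ) - χ y)| := by
        rw [abs_mul, abs_of_pos (mul_pos hc0 hN0)]
    _ ≤ c * (N : ℝ) * (B * ((15 : ℝ) * ρ) ^ (d + 1)) := mul_le_mul_of_nonneg_left hsum (by positivity)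
    _ = C₀ * (15 : ℝ) ^ (d + 1) * ((c * (N : ℝ) * (((N : ℝ) / ρ) ^ d * ρ ^ (d + 1))) / R) := by rw [hBdef]; ring
    _ = C₀ * (15 : ℝ) ^ (d + 1) * (ρ / R) := by rw [hcN]
    _ ≤ C₀ * (15 : ℝ) ^ (d + 1) * 1 := mul_le_mul_of_nonneg_left hρR (by positivity)
    _ = C₀ * (15 : ℝ) ^ (d + 1) := mul_one _

/-! ## §3 The exact four-term split -/

omit [NeZero L] in
/-- **THE EXACT FOUR-TERM SPLIT** of `Σ_y c·DD′(y)λ(y) − Σ_y c·DD(y)λ(y)` when both kernels have zero sum (`Σ DD′ = Σ DD = 0`): for any weight `w` and values `λx, λx′`,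
`= Σ cDD′w(λ − λx′) − Σ cDDw(λ − λx) + Σ c(DD′ − DD)(1 − w)(λ − λx) + (λx′ − λx)·Σ cDD′w` (the two cancellations absorb the constants; pure algebra) — the
Calderón–Zygmund split of [B9]'s (3.45) object at `U ≡ 1` into near ∕ near ∕ far ∕ boundary terms.
[cite: Balaban1985BackgroundPropagators, Thm 3.1 (3.45) p.398 (the object); King1986, (2.13) p.653] -/
theorem mixedKernel_holder_split {T : Type*} [Fintype T] (c lx lx' : ℝ) (DD DD' w lam : T → ℝ)
    (hDD : ∑ y, DD y = 0) (hDD' : ∑ y, DD' y = 0) :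
    ∑ y, c * DD' y * lam y - ∑ y, c * DD y * lam y
      = ∑ y, c * DD' y * w y * (lam y - lx') - ∑ y, c * DD y * w y * (lam y - lx)
        + ∑ y, c * (DD' y - DD y) * (1 - w y) * (lam y - lx) + (lx' - lx) * ∑ y, c * DD' y * w y := by
  have key : ∀ y, c * DD' y * w y * (lam y - lx') - c * DD y * w y * (lam y - lx)
        + c * (DD' y - DD y) * (1 - w y) * (lam y - lx) + (lx' - lx) * (c * DD' y * w y)
      = (c * DD' y * lam y - c * DD y * lam y) + lx * c * (DD y - DD' y) := fun y => by ring
  have hz : ∑ y, lx * c * (DD y - DD' y) = 0 := by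
    rw [← Finset.mul_sum, Finset.sum_sub_distrib, hDD, hDD', sub_self, mul_zero]
  have hR : ∑ y, c * DD' y * w y * (lam y - lx') - ∑ y, c * DD y * w y * (lam y - lx)
        + ∑ y, c * (DD' y - DD y) * (1 - w y) * (lam y - lx) + (lx' - lx) * ∑ y, c * DD' y * w y
      = ∑ y, (c * DD' y * w y * (lam y - lx') - c * DD y * w y * (lam y - lx)
        + c * (DD' y - DD y) * (1 - w y) * (lam y - lx) + (lx' - lx) * (c * DD' y * w y)) := by
    rw [Finset.sum_add_distrib, Finset.sum_add_distrib, Finset.sum_sub_distrib, Finset.mul_sum]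
  rw [hR, Finset.sum_congr rfl fun y _ => key y, Finset.sum_add_distrib, hz, add_zero, Finset.sum_sub_distrib]

end Summit.QuantumFields.YangMills.BalabanUVNodes.N15KingModelRung.Curved
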